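import Summits.AtomisticToContinuum.Crystallization.Theorems.OverbindingBudgetAffineRadialGlue
import Summits.AtomisticToContinuum.Crystallization.Theorems.OverbindingBudgetAffineRadialChart

/-!
# The Gram chart fits the chart dictionary (NODE 68, deliverable (K5), part 2: the remaining obligations, stated)

The sibling `…RadialChart` constructs, for every sign window at once, the chart map `gramChart`, the normalising length
`chartScale`, the convex region `KRegion (196/121)` and proves the dictionary obligations `scale_pos` and `mem_K` of
`…RadialGlue.ChartDictionary` at `θ = 1/25`.  This file records what is LEFT, as explicit hypothesis types, and closes the
chain to the Z2 leaf:

* `chartDictionary_of_obligations`: a `ChartDictionary (1/25) θ' w D (KRegion (196/121)) x₀ r₁` from the THREE remaining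
  per-window obligations for the Gram chart —
  (far)   `FarWindowData (1/25) θ' w X → r₁ ≤ ‖gramChart X − x₀‖` (the far clause excludes the Gram ball; Cholesky of the
          normalised Gram matrix in the reduced basis gives the isometry that the far clause forbids),
  (upper) `FarWindowData (1/25) θ' w X → chartScale X⁶ · windowSixUp w X ≤ D.P (gramChart X)` and
  (lower) `FarWindowData (1/25) θ' w X → D.N (gramChart X) ≤ chartScale X¹² · windowTwelveLo w X` (the window sums against
          the finite near family — an EQUALITY termwise by `normSq_wPos_eq_chart` — plus certified far-field constants);
* `farCoreExcess_of_gramChartTables`: the Z2 leaf `FarCoreExcess (1/25) (1/2000) (1/(2·10⁷))` from those three obligation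
  families, the radial tables (C)/(B)/(G) of `…RadialReduction` on the regions `KRegion (196/121)` (star-convex about any
  centre inside them, `starConvex_KRegion`), the numeric side conditions and the hcp enclosures — `farCoreExcess_of_radialTables`
  with the dictionary instantiated.
No `sorry`; only `propext`, `Classical.choice`, `Quot.sound`.
-/

noncomputable section

namespace Summit.AtomisticToContinuum.Crystallization.Theorems.OverbindingBudgetAffineRadialChartFit

open Set
open Literature.MathematicalPhysics.StatisticalMechanics
open Summit.AtomisticToContinuum.Crystallization.Theorems.OverbindingBudgetAffineFarSmoothSplit
open Summit.AtomisticToContinuum.Crystallization.Theorems.OverbindingBudgetAffineRadialReduction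
open Summit.AtomisticToContinuum.Crystallization.Theorems.OverbindingBudgetAffineRadialGlue
open Summit.AtomisticToContinuum.Crystallization.Theorems.OverbindingBudgetAffineRadialChart

local notation "E3" => EuclideanSpace ℝ (Fin 3)
local notation "E5" => EuclideanSpace ℝ (Fin 5)

/-- ★ The Gram chart `(gramChart, chartScale)` with region `KRegion (196/121)` IS a chart dictionary of the window `w` at
`θ = 1/25`, given the three remaining obligations (far), (upper), (lower) for that window. [this file] -/
def chartDictionary_of_obligations {θ' : ℝ} {ι : Type*} (w : Fin 6 → ℤ) (D : FamilyData E5 ι) (x₀ : E5) (r₁ : ℝ)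
    (hfar : ∀ X : E3 →ₗ[ℝ] E3, FarWindowData (1 / 25) θ' w X → r₁ ≤ ‖gramChart X - x₀‖)
    (hupper : ∀ X : E3 →ₗ[ℝ] E3, FarWindowData (1 / 25) θ' w X → chartScale X ^ 6 * windowSixUp w X ≤ D.P (gramChart X))
    (hlower : ∀ X : E3 →ₗ[ℝ] E3, FarWindowData (1 / 25) θ' w X → D.N (gramChart X) ≤ chartScale X ^ 12 * windowTwelveLo w X) :
    ChartDictionary (1 / 25) θ' w D (KRegion (196 / 121)) x₀ r₁ where
  chart X _ := gramChart X
  scale X _ := chartScale X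
  scale_pos X _ hX _ _ := scale_pos_of_farWindowData (by norm_num) hX
  mem_K X _ hX _ _ := mem_K_record hX
  far X _ hX _ _ := hfar X hX
  upper X _ hX _ _ := hupper X hX
  lower X _ hX _ _ := hlower X hX

/-- ★★ **Z2 from Gram-chart tables.**  For every sign window `w`: an inverse-power family `D w` on `E5` (near family read off by
`normSq_wPos_eq_chart` + far-field constants), a centre `x₀ w ∈ KRegion (196/121)`, radii `0 < r₁ w ≤ ρ w` and constants
`m₀ w, η w, δ₀ w` with the three chart obligations (far)/(upper)/(lower), the radial tables (C) convex core / (B) slope-or-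
curvature / (G),(0) centre data of `…RadialReduction` on `KRegion (196/121)`, the side conditions, `0 ≤ b`,
`L6hi ≤ b·(l3² − 24κ″L6hi)` and the hcp enclosures ⇒ `FarCoreExcess (1/25) (1/2000) (1/(2·10⁷))`. [this file] -/
theorem farCoreExcess_of_gramChartTables {ι : Type*} {c τ l3 L6hi b : ℝ}
    {D : (Fin 6 → ℤ) → FamilyData E5 ι} {x₀ : (Fin 6 → ℤ) → E5} {ρ m₀ η δ₀ r₁ : (Fin 6 → ℤ) → ℝ}
    (hc : c ≠ 0) (hτ : 0 < τ) (hτ' : τ ≤ 1 / 100)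
    (hl3 : 0 < l3) (hL3 : l3 ≤ StackingSums.hcpInvPowSum 3 c) (hL6 : StackingSums.hcpInvPowSum 6 c ≤ L6hi)
    (hκ : 24 * (1 / (2 * 10 ^ 7) + 1 / 10 ^ 9) * L6hi ≤ l3 ^ 2)
    (hfar : ∀ w, ∀ X : E3 →ₗ[ℝ] E3, FarWindowData (1 / 25) (1 / 2000 - τ) w X → r₁ w ≤ ‖gramChart X - x₀ w‖)
    (hupper : ∀ w, ∀ X : E3 →ₗ[ℝ] E3, FarWindowData (1 / 25) (1 / 2000 - τ) w X →
      chartScale X ^ 6 * windowSixUp w X ≤ (D w).P (gramChart X))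
    (hlower : ∀ w, ∀ X : E3 →ₗ[ℝ] E3, FarWindowData (1 / 25) (1 / 2000 - τ) w X →
      (D w).N (gramChart X) ≤ chartScale X ^ 12 * windowTwelveLo w X)
    (hx₀ : ∀ w, x₀ w ∈ KRegion (196 / 121))
    (hpos : ∀ w, ∀ y ∈ KRegion (196 / 121), ∀ i ∈ (D w).s, (D w).c i + (D w).L i y ≠ 0)
    (hP : ∀ w, ∀ y ∈ KRegion (196 / 121), 0 < (D w).P y)
    (hC : ∀ w, ∀ y ∈ KRegion (196 / 121), ‖y - x₀ w‖ ≤ ρ w → ∀ u : E5, ‖u‖ = 1 → m₀ w ≤ (D w).psi₂ y u)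
    (hB : ∀ w, ∀ y ∈ KRegion (196 / 121), ρ w ≤ ‖y - x₀ w‖ →
      0 < (D w).psi₁ y (‖y - x₀ w‖⁻¹ • (y - x₀ w)) ∨ 0 < (D w).psi₂ y (‖y - x₀ w‖⁻¹ • (y - x₀ w)))
    (hG : ∀ w, ∀ u : E5, ‖u‖ = 1 → -η w ≤ (D w).psi₁ (x₀ w) u) (h0 : ∀ w, b - δ₀ w ≤ (D w).psi (x₀ w))
    (hr₁ : ∀ w, 0 < r₁ w) (hrρ : ∀ w, r₁ w ≤ ρ w)
    (hq : ∀ w, ∀ t ∈ Icc (r₁ w) (ρ w), δ₀ w + η w * t ≤ m₀ w / 2 * t ^ 2) (hρη : ∀ w, η w < m₀ w * ρ w)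
    (hb : 0 ≤ b) (hbD : L6hi ≤ b * (l3 ^ 2 - 24 * (1 / (2 * 10 ^ 7) + 1 / 10 ^ 9) * L6hi)) :
    FarCoreExcess (1 / 25) (1 / 2000) (1 / (2 * 10 ^ 7)) :=
  farCoreExcess_of_radialTables (K := fun _ => KRegion (196 / 121)) hc hτ hτ' hl3 hL3 hL6 hκ
    (fun w => chartDictionary_of_obligations w (D w) (x₀ w) (r₁ w) (hfar w) (hupper w) (hlower w))
    (fun w => starConvex_KRegion _ (hx₀ w)) hpos hP hC hB hG h0 hr₁ hrρ hq hρη hb hbD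

end Summit.AtomisticToContinuum.Crystallization.Theorems.OverbindingBudgetAffineRadialChartFit

end
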